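import Summits.KontsevichZagierPeriods.KontsevichZagierPeriods.Theorems.HurwitzMicroSectorsNormalFormPrincipleDilogExistsBoxAtoms
import Literature.NumberTheory.Transcendental.EllIterRep

/-!
# `NormalFormPrinciple` (stmt-KontsevichZagierPeriods-3869), line `SketchIdeator1` —
# leaf `stub_boxRigidity`, dilogarithm layer: the pieces of the `ζ(2)`-simplex exist

Pure proof file (stub `exists_simplexPieces_two` of the layer `Dilog`, lead seat c9; `--supports`
the crux). The dilogarithm functional equations (reflection, Landen, duplication) are proved by the
lead as move chains of the Kontsevich–Zagier calculus between box atoms and pieces of the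
`ζ(2)`-simplex `S = [{0 < t₁ < t₀ < 1}, 1/(t₀(1 − t₁))]` (`t₀` outer, `t₁` inner variable). For a
real algebraic parameter `0 < z < 1` this file supplies the EXISTENCE, as honest integral
representations (`Literature.NumberTheory.Transcendental.KZ.IntegralRep 2`), of four pieces:

* the upper triangle `B(z) = [{z < t₁ < t₀ < 1}, 1/(t₀(1 − t₁))]` (value `Li₂(1 − z)`; the
  integrand is unbounded near `t₁ → 1`);
* the rectangle `C(z) = [{0 < t₁ < z < t₀ < 1}, 1/(t₀(1 − t₁))]` (value `−log z · log(1 − z)`);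
* the triangle `Q(z) = [{0 < t₁ < t₀ < z}, 1/((1 − t₀)(1 − t₁))]`;
* the square `R(z) = [(0,z)², 1/((1 − t₀)(1 − t₁))]` (value `log²(1 − z)`).

The domains are finite intersections of half-planes `{c < tᵢ}`, `{tᵢ < c}` with real algebraic
`c ∈ {0, 1, z}` (`KZ.isSemialgebraic_setOf_const_lt_apply`, `KZ.isSemialgebraic_setOf_apply_lt_const`)
and of `{t₁ < t₀}`; the integrands are quotients of `ℚ`-polynomials with non-vanishing
denominators (`isSemialgebraicFunOn_aeval_div_aeval`). The integrands of `C`, `Q`, `R` extend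
continuously to the compact closures `[z,1] × [0,z]`, `[0,z]²`, so they are integrable
(`ContinuousOn.integrableOn_Icc`). The integrand of `B(z)` is transported by Mathlib's Jacobian
criterion (`MeasureTheory.integrableOn_image_iff_integrableOn_abs_det_fderiv_smul`) along the
chart `Ψ(x₀,x₁) = (1 − c x₀x₁, 1 − c x₀)`, `c = 1 − z`, of the triangle by the open unit box
(`|det DΨ| = c² x₀`): its pull-back `c² x₀ / ((1 − c x₀x₁) · c x₀) = 1/(1/c − x₀x₁)` is the
dilogarithm integrand with parameter `1/c ≥ 1`, integrable on the box
(`integrableOn_dilogIntegrand`, stub `exists_boxAtoms`).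

References: M. Kontsevich, D. Zagier, *Periods* (2001), §1.1–1.2 (rule (2)). No definitions are
introduced.
-/

noncomputable section

open MeasureTheory Set
open Literature.NumberTheory.Transcendental Literature.NumberTheory.Transcendental.KZ
open Literature.ModelTheory.ExponentialFields (IsSemialgebraic isSemialgebraic_setOf_eval_lt)

namespace Summit.KontsevichZagierPeriods.HurwitzMicroSectors.NormalFormPrinciple.PiBox.Dilog

/-! ## The domains are `ℚ`-semialgebraic -/

/-- The open half-plane `{t | t₁ < t₀}` of `ℝ²` is `ℚ`-semialgebraic (a strict `ℚ`-polynomial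
inequality). [folklore] -/
theorem spB_isSemialgebraic_setOf_apply_one_lt_apply_zero :
    IsSemialgebraic ℚ {t : Fin 2 → ℝ | t 1 < t 0} := by
  simpa only [MvPolynomial.aeval_X] using
    isSemialgebraic_setOf_eval_lt (R := ℝ) (MvPolynomial.X 1 : MvPolynomial (Fin 2) ℚ)
      (MvPolynomial.X 0)

/-- The triangle `{a < t₁ < t₀ < b}` is `ℚ`-semialgebraic for real algebraic `a`, `b` (used with
`(a, b) = (z, 1)` for the upper triangle and `(a, b) = (0, z)` for the lower one).
[cite: KontsevichZagier2001, §1.1] -/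
theorem spB_isSemialgebraic_triangle {a b : ℝ} (ha : IsAlgebraic ℚ a) (hb : IsAlgebraic ℚ b) :
    IsSemialgebraic ℚ {t : Fin 2 → ℝ | a < t 1 ∧ t 1 < t 0 ∧ t 0 < b} :=
  (isSemialgebraic_setOf_const_lt_apply ha (1 : Fin 2)).inter
    (spB_isSemialgebraic_setOf_apply_one_lt_apply_zero.inter
      (isSemialgebraic_setOf_apply_lt_const hb (0 : Fin 2)))

/-- The rectangle `{0 < t₁ < z < t₀ < 1} = (z,1) × (0,z)` is `ℚ`-semialgebraic for real algebraic
`z`. [cite: KontsevichZagier2001, §1.1] -/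
theorem spB_isSemialgebraic_rect {z : ℝ} (hz : IsAlgebraic ℚ z) :
    IsSemialgebraic ℚ {t : Fin 2 → ℝ | 0 < t 1 ∧ t 1 < z ∧ z < t 0 ∧ t 0 < 1} :=
  (isSemialgebraic_setOf_const_lt_apply isAlgebraic_zero (1 : Fin 2)).inter
    ((isSemialgebraic_setOf_apply_lt_const hz (1 : Fin 2)).inter
      ((isSemialgebraic_setOf_const_lt_apply hz (0 : Fin 2)).inter
        (isSemialgebraic_setOf_apply_lt_const isAlgebraic_one (0 : Fin 2))))

/-- The square `(0,z)²` is `ℚ`-semialgebraic for real algebraic `z`.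
[cite: KontsevichZagier2001, §1.1] -/
theorem spB_isSemialgebraic_square {z : ℝ} (hz : IsAlgebraic ℚ z) :
    IsSemialgebraic ℚ {t : Fin 2 → ℝ | 0 < t 0 ∧ t 0 < z ∧ 0 < t 1 ∧ t 1 < z} :=
  (isSemialgebraic_setOf_const_lt_apply isAlgebraic_zero (0 : Fin 2)).inter
    ((isSemialgebraic_setOf_apply_lt_const hz (0 : Fin 2)).inter
      ((isSemialgebraic_setOf_const_lt_apply isAlgebraic_zero (1 : Fin 2)).inter
        (isSemialgebraic_setOf_apply_lt_const hz (1 : Fin 2))))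

/-! ## The integrands are `ℚ`-semialgebraic -/

/-- The `ζ(2)` integrand `1/(t₀(1 − t₁))` is a `ℚ`-semialgebraic function on every
`ℚ`-semialgebraic set on which its denominator does not vanish (a quotient of `ℚ`-polynomials).
[cite: KontsevichZagier2001, §1.1] -/
theorem spB_isSemialgebraicFunOn_zetaTwoIntegrand {s : Set (Fin 2 → ℝ)} (hs : IsSemialgebraic ℚ s)
    (h : ∀ t ∈ s, t 0 * (1 - t 1) ≠ 0) :
    IsSemialgebraicFunOn ℚ s (fun t => 1 / (t 0 * (1 - t 1))) :=
  (isSemialgebraicFunOn_aeval_div_aeval hs 1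
    (MvPolynomial.X 0 * (1 - MvPolynomial.X 1) : MvPolynomial (Fin 2) ℚ)
    fun t ht => by simpa only [map_mul, map_sub, map_one, MvPolynomial.aeval_X] using h t ht).congr
    fun t _ => by simp only [map_mul, map_sub, map_one, MvPolynomial.aeval_X]

/-- The integrand `1/((1 − t₀)(1 − t₁))` is a `ℚ`-semialgebraic function on every
`ℚ`-semialgebraic set on which its denominator does not vanish (a quotient of `ℚ`-polynomials).
[cite: KontsevichZagier2001, §1.1] -/
theorem spB_isSemialgebraicFunOn_logSqIntegrand {s : Set (Fin 2 → ℝ)} (hs : IsSemialgebraic ℚ s)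
    (h : ∀ t ∈ s, (1 - t 0) * (1 - t 1) ≠ 0) :
    IsSemialgebraicFunOn ℚ s (fun t => 1 / ((1 - t 0) * (1 - t 1))) :=
  (isSemialgebraicFunOn_aeval_div_aeval hs 1
    ((1 - MvPolynomial.X 0) * (1 - MvPolynomial.X 1) : MvPolynomial (Fin 2) ℚ)
    fun t ht => by simpa only [map_mul, map_sub, map_one, MvPolynomial.aeval_X] using h t ht).congr
    fun t _ => by simp only [map_mul, map_sub, map_one, MvPolynomial.aeval_X]

/-! ## Absolute convergence on the bounded pieces `C`, `Q`, `R` -/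

/-- On the rectangle `(z,1) × (0,z)` (`0 < z < 1`) the `ζ(2)` integrand `1/(t₀(1 − t₁))` is
integrable: it is continuous on the compact closure `[z,1] × [0,z]`, where `t₀ ≥ z > 0` and
`1 − t₁ ≥ 1 − z > 0`. [folklore] -/
theorem spB_integrableOn_rect {z : ℝ} (hz0 : 0 < z) (hz1 : z < 1) :
    IntegrableOn (fun t : Fin 2 → ℝ => 1 / (t 0 * (1 - t 1)))
      {t | 0 < t 1 ∧ t 1 < z ∧ z < t 0 ∧ t 0 < 1} := by
  have hK : IntegrableOn (fun t : Fin 2 → ℝ => 1 / (t 0 * (1 - t 1))) (Icc ![z, 0] ![1, z]) := by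
    refine ContinuousOn.integrableOn_Icc
      (ContinuousOn.div continuousOn_const (by fun_prop) fun t ht => ?_)
    simp only [mem_Icc, Pi.le_def, Fin.forall_fin_two, Matrix.cons_val_zero,
      Matrix.cons_val_one] at ht
    exact (mul_pos (hz0.trans_le ht.1.1) (by linarith [ht.2.2])).ne'
  refine hK.mono_set fun t ht => ?_
  obtain ⟨h1, h2, h3, h4⟩ := ht
  simp only [mem_Icc, Pi.le_def, Fin.forall_fin_two, Matrix.cons_val_zero, Matrix.cons_val_one]
  exact ⟨⟨h3.le, h1.le⟩, h4.le, h2.le⟩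

/-- On a subset of the square `(0,z)²` (`z < 1`) the integrand `1/((1 − t₀)(1 − t₁))` is
integrable: it is continuous on the compact closure `[0,z]²`, where both factors of the
denominator are `≥ 1 − z > 0`. [folklore] -/
theorem spB_integrableOn_of_subset_square {z : ℝ} (hz1 : z < 1) {s : Set (Fin 2 → ℝ)}
    (hs : s ⊆ Icc ![0, 0] ![z, z]) :
    IntegrableOn (fun t : Fin 2 → ℝ => 1 / ((1 - t 0) * (1 - t 1))) s := by
  have hK : IntegrableOn (fun t : Fin 2 → ℝ => 1 / ((1 - t 0) * (1 - t 1)))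
      (Icc ![0, 0] ![z, z]) := by
    refine ContinuousOn.integrableOn_Icc
      (ContinuousOn.div continuousOn_const (by fun_prop) fun t ht => ?_)
    simp only [mem_Icc, Pi.le_def, Fin.forall_fin_two, Matrix.cons_val_zero,
      Matrix.cons_val_one] at ht
    exact (mul_pos (by linarith [ht.2.1]) (by linarith [ht.2.2])).ne'
  exact hK.mono_set hs

/-- The triangle `{0 < t₁ < t₀ < z}` lies in the closed square `[0,z]²`. [folklore] -/
theorem spB_lower_subset_Icc (z : ℝ) :
    {t : Fin 2 → ℝ | 0 < t 1 ∧ t 1 < t 0 ∧ t 0 < z} ⊆ Icc ![0, 0] ![z, z] := by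
  rintro t ⟨h1, h2, h3⟩
  simp only [mem_Icc, Pi.le_def, Fin.forall_fin_two, Matrix.cons_val_zero, Matrix.cons_val_one]
  exact ⟨⟨by linarith, h1.le⟩, h3.le, by linarith⟩

/-- The open square `(0,z)²` lies in the closed square `[0,z]²`. [folklore] -/
theorem spB_square_subset_Icc (z : ℝ) :
    {t : Fin 2 → ℝ | 0 < t 0 ∧ t 0 < z ∧ 0 < t 1 ∧ t 1 < z} ⊆ Icc ![0, 0] ![z, z] := by
  rintro t ⟨h1, h2, h3, h4⟩
  simp only [mem_Icc, Pi.le_def, Fin.forall_fin_two, Matrix.cons_val_zero, Matrix.cons_val_one]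
  exact ⟨⟨h1.le, h3.le⟩, h2.le, h4.le⟩

/-! ## The chart of the upper triangle by the unit box and absolute convergence on `B` -/

/-- **The pull-back identity** of the chart `Ψ(x₀,x₁) = (1 − c x₀x₁, 1 − c x₀)`, Jacobian
`c² x₀` included: `1/(1/c − x₀x₁) = c² x₀ · 1/((1 − c x₀x₁)(1 − (1 − c x₀)))` whenever
`c, x₀, 1 − c x₀x₁ ≠ 0`. [folklore] -/
theorem spB_upper_pullback {c u v : ℝ} (hc : c ≠ 0) (hu : u ≠ 0) (h : 1 - c * u * v ≠ 0) :
    1 / (1 / c - u * v) = c ^ 2 * u * (1 / ((1 - c * u * v) * (1 - (1 - c * u)))) := by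
  rw [div_sub' hc, ← mul_assoc, one_div_div, sub_sub_cancel, mul_one_div,
    div_eq_div_iff h (mul_ne_zero h (mul_ne_zero hc hu))]
  ring

/-- **The chart `Ψ(x₀,x₁) = (1 − c x₀x₁, 1 − c x₀)` of the upper triangle
`{1 − c < t₁ < t₀ < 1}` by the open unit box** (`c > 0` real algebraic): a `ℚ`-semialgebraic map
(polynomial in the coordinates and the algebraic constant `c`), differentiable with derivative
`(−c x₁, −c x₀; −c, 0)` of determinant `−c² x₀`, injective on the box and ONTO the triangle
(inverse `x₀ = (1 − t₁)/c`, `x₁ = (1 − t₀)/(1 − t₁)`). Pattern of `KZ.exists_dirichletPolarChart`.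
[cite: KontsevichZagier2001, §1.2 rule (2)] -/
theorem spB_exists_upperChart {c : ℝ} (hca : IsAlgebraic ℚ c) (hc : 0 < c) :
    ∃ (Ψ : (Fin 2 → ℝ) → (Fin 2 → ℝ)) (Ψ' : (Fin 2 → ℝ) → (Fin 2 → ℝ) →L[ℝ] (Fin 2 → ℝ)),
      (∀ x, Ψ x 0 = 1 - c * x 0 * x 1) ∧ (∀ x, Ψ x 1 = 1 - c * x 0) ∧
      IsSemialgebraicMapOn ℚ {x : Fin 2 → ℝ | ∀ i, x i ∈ Set.Ioo (0:ℝ) 1} Ψ ∧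
      (∀ x, HasFDerivAt Ψ (Ψ' x) x) ∧
      Set.InjOn Ψ {x : Fin 2 → ℝ | ∀ i, x i ∈ Set.Ioo (0:ℝ) 1} ∧
      Ψ '' {x : Fin 2 → ℝ | ∀ i, x i ∈ Set.Ioo (0:ℝ) 1} =
        {t | 1 - c < t 1 ∧ t 1 < t 0 ∧ t 0 < 1} ∧
      (∀ x ∈ {x : Fin 2 → ℝ | ∀ i, x i ∈ Set.Ioo (0:ℝ) 1}, |(Ψ' x).det| = c ^ 2 * x 0) := by
  set Ψ : (Fin 2 → ℝ) → (Fin 2 → ℝ) := fun x => ![1 - c * x 0 * x 1, 1 - c * x 0]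
  set Ψ' : (Fin 2 → ℝ) → (Fin 2 → ℝ) →L[ℝ] (Fin 2 → ℝ) :=
    fun x => LinearMap.toContinuousLinearMap (Matrix.toLin' !![-c * x 1, -c * x 0; -c, 0])
  have hΨ0 : ∀ x, Ψ x 0 = 1 - c * x 0 * x 1 := fun x => rfl
  have hΨ1 : ∀ x, Ψ x 1 = 1 - c * x 0 := fun x => rfl
  have hΨ'0 : ∀ x v : Fin 2 → ℝ, Ψ' x v 0 = -c * x 1 * v 0 + -c * x 0 * v 1 := by
    intro x v
    change Matrix.toLin' !![-c * x 1, -c * x 0; -c, 0] v 0 = _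
    rw [Matrix.toLin'_apply]
    simp [Matrix.mulVec, dotProduct, Fin.sum_univ_two]
  have hΨ'1 : ∀ x v : Fin 2 → ℝ, Ψ' x v 1 = -c * v 0 := by
    intro x v
    change Matrix.toLin' !![-c * x 1, -c * x 0; -c, 0] v 1 = _
    rw [Matrix.toLin'_apply]
    simp [Matrix.mulVec, dotProduct, Fin.sum_univ_two]
  have hdet : ∀ x, (Ψ' x).det = -(c ^ 2 * x 0) := by
    intro x
    change LinearMap.det (Matrix.toLin' !![-c * x 1, -c * x 0; -c, 0]) = _
    rw [LinearMap.det_toLin', Matrix.det_fin_two_of]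
    ring
  have hderiv : ∀ x, HasFDerivAt Ψ (Ψ' x) x := by
    intro x
    have h0 : HasFDerivAt (fun y : Fin 2 → ℝ => y 0)
        (ContinuousLinearMap.proj (R := ℝ) (φ := fun _ : Fin 2 => ℝ) 0) x := hasFDerivAt_apply 0 x
    have h1 : HasFDerivAt (fun y : Fin 2 → ℝ => y 1)
        (ContinuousLinearMap.proj (R := ℝ) (φ := fun _ : Fin 2 => ℝ) 1) x := hasFDerivAt_apply 1 x
    rw [hasFDerivAt_pi']
    refine Fin.forall_fin_two.mpr ⟨?_, ?_⟩
    · have hf : (fun y : Fin 2 → ℝ => Ψ y 0) = fun y => 1 - c * y 0 * y 1 := funext fun y => rfl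
      rw [hf]
      refine (((h0.const_mul c).mul h1).const_sub 1).congr_fderiv
        (ContinuousLinearMap.ext fun v => ?_)
      simp [hΨ'0]
      ring
    · have hf : (fun y : Fin 2 → ℝ => Ψ y 1) = fun y => 1 - c * y 0 := funext fun y => rfl
      rw [hf]
      refine ((h0.const_mul c).const_sub 1).congr_fderiv (ContinuousLinearMap.ext fun v => ?_)
      simp [hΨ'1]
  refine ⟨Ψ, Ψ', hΨ0, hΨ1, ?_, hderiv, ?_, ?_, fun x hx => ?_⟩
  · -- `ℚ`-semialgebraic: coordinatewise polynomial in `x₀, x₁` and the algebraic constant `c`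
    have hB := isSemialgebraic_box 2
    refine IsSemialgebraicMapOn.of_forall hB (Fin.forall_fin_two.mpr ⟨?_, ?_⟩)
    · exact (IsSemialgebraicFunOn.sub_holds
        (isSemialgebraicFunOn_const_of_isAlgebraic hB isAlgebraic_one)
        (IsSemialgebraicFunOn.mul_holds (IsSemialgebraicFunOn.mul_holds
          (isSemialgebraicFunOn_const_of_isAlgebraic hB hca) (isSemialgebraicFunOn_apply hB 0))
          (isSemialgebraicFunOn_apply hB 1))).congr fun _ _ => rfl
    · exact (IsSemialgebraicFunOn.sub_holds
        (isSemialgebraicFunOn_const_of_isAlgebraic hB isAlgebraic_one)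
        (IsSemialgebraicFunOn.mul_holds (isSemialgebraicFunOn_const_of_isAlgebraic hB hca)
          (isSemialgebraicFunOn_apply hB 0))).congr fun _ _ => rfl
  · -- injective on the box
    intro x hx y hy hxy
    have e0 := congrFun hxy 0
    have e1 := congrFun hxy 1
    simp only [hΨ0, hΨ1] at e0 e1
    have h0 : x 0 = y 0 := mul_left_cancel₀ hc.ne' (by linarith)
    have h1 : x 1 = y 1 := by
      rw [← h0] at e0
      exact mul_left_cancel₀ (mul_pos hc (hx 0).1).ne' (by linarith)
    funext i
    fin_cases i
    · exact h0
    · exact h1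
  · -- onto the triangle
    ext t
    constructor
    · rintro ⟨x, hx, rfl⟩
      simp only [mem_setOf_eq, hΨ0, hΨ1]
      have hcx : 0 < c * x 0 := mul_pos hc (hx 0).1
      have h1 : c * x 0 < c := mul_lt_of_lt_one_right hc (hx 0).2
      have h2 : c * x 0 * x 1 < c * x 0 := mul_lt_of_lt_one_right hcx (hx 1).2
      have h3 : 0 < c * x 0 * x 1 := mul_pos hcx (hx 1).1
      exact ⟨by linarith, by linarith, by linarith⟩
    · rintro ⟨h1, h2, h3⟩
      have ht1 : 0 < 1 - t 1 := by linarith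
      have ht0 : 0 < 1 - t 0 := by linarith
      refine ⟨![(1 - t 1) / c, (1 - t 0) / (1 - t 1)], Fin.forall_fin_two.mpr ⟨?_, ?_⟩, ?_⟩
      · change (1 - t 1) / c ∈ Set.Ioo (0:ℝ) 1
        exact ⟨div_pos ht1 hc, by rw [div_lt_one hc]; linarith⟩
      · change (1 - t 0) / (1 - t 1) ∈ Set.Ioo (0:ℝ) 1
        exact ⟨div_pos ht0 ht1, by rw [div_lt_one ht1]; linarith⟩
      · funext i
        fin_cases i
        · change 1 - c * ((1 - t 1) / c) * ((1 - t 0) / (1 - t 1)) = t 0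
          rw [mul_div_cancel₀ _ hc.ne', mul_div_cancel₀ _ ht1.ne']
          ring
        · change 1 - c * ((1 - t 1) / c) = t 1
          rw [mul_div_cancel₀ _ hc.ne']
          ring
  · -- the Jacobian
    rw [hdet, abs_neg, abs_of_pos (mul_pos (pow_pos hc 2) (hx 0).1)]

/-- **Absolute convergence on the upper triangle.** For `0 < z < 1` the `ζ(2)` integrand
`1/(t₀(1 − t₁))` is integrable on `{z < t₁ < t₀ < 1}`: by the Jacobian criterion along the chart
`Ψ` of `spB_exists_upperChart` (`c = 1 − z`) this is the integrability on the open unit box of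
`|det DΨ| · (1/(t₀(1 − t₁))) ∘ Ψ = 1/(1/c − x₀x₁)`, the dilogarithm integrand with parameter
`1/c ≥ 1` (`integrableOn_dilogIntegrand`). [cite: KontsevichZagier2001, §1.2 rule (2)] -/
theorem spB_integrableOn_upper {z : ℝ} (hz : IsAlgebraic ℚ z) (hz0 : 0 < z) (hz1 : z < 1) :
    IntegrableOn (fun t : Fin 2 → ℝ => 1 / (t 0 * (1 - t 1)))
      {t | z < t 1 ∧ t 1 < t 0 ∧ t 0 < 1} := by
  have hc : 0 < 1 - z := sub_pos.2 hz1
  have hc1 : 1 - z ≤ 1 := by linarith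
  obtain ⟨Ψ, Ψ', hΨ0, hΨ1, -, hderiv, hinj, himage, hdet⟩ :=
    spB_exists_upperChart (isAlgebraic_one.sub hz) hc
  rw [sub_sub_cancel] at himage
  have hB : MeasurableSet {x : Fin 2 → ℝ | ∀ i, x i ∈ Set.Ioo (0:ℝ) 1} :=
    (isSemialgebraic_box 2).measurableSet_holds
  -- the pull-back of the integrand to the box is the dilogarithm integrand with parameter `1/c`
  have hbox : IntegrableOn (fun x => |(Ψ' x).det| • (1 / (Ψ x 0 * (1 - Ψ x 1))))
      {x : Fin 2 → ℝ | ∀ i, x i ∈ Set.Ioo (0:ℝ) 1} := by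
    refine (integrableOn_dilogIntegrand (a := 1 / (1 - z)) (Or.inl (one_le_one_div hc hc1))).congr_fun
      (fun x hx => ?_) hB
    have hlt : (1 - z) * x 0 * x 1 < 1 := by
      rw [mul_assoc]
      have hp := mul_mem_Ioo_of_mem_box hx
      exact mul_lt_one_of_nonneg_of_lt_one_right hc1 hp.1.le hp.2
    simp only [smul_eq_mul, hdet x hx, hΨ0, hΨ1]
    exact spB_upper_pullback hc.ne' (hx 0).1.ne' (sub_pos.2 hlt).ne'
  have hT := (integrableOn_image_iff_integrableOn_abs_det_fderiv_smul volume hB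
    (fun x _ => (hderiv x).hasFDerivWithinAt) hinj (fun t : Fin 2 → ℝ => 1 / (t 0 * (1 - t 1)))).2
    hbox
  rwa [himage] at hT

/-! ## Existence of the four pieces -/

/-- **The upper triangle `B(z) = [{z < t₁ < t₀ < 1}, 1/(t₀(1 − t₁))]` exists** for real algebraic
`0 < z < 1` (value `Li₂(1 − z)`). [cite: KontsevichZagier2001, §1.1] -/
theorem spB_exists_upper {z : ℝ} (hz : IsAlgebraic ℚ z) (hz0 : 0 < z) (hz1 : z < 1) :
    ∃ B : IntegralRep 2, B.domain = {t | z < t 1 ∧ t 1 < t 0 ∧ t 0 < 1} ∧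
      B.integrand = fun t => 1 / (t 0 * (1 - t 1)) :=
  ⟨⟨_, _, spB_isSemialgebraic_triangle hz isAlgebraic_one,
    spB_isSemialgebraicFunOn_zetaTwoIntegrand (spB_isSemialgebraic_triangle hz isAlgebraic_one)
      fun _ ht =>
      (mul_pos (hz0.trans (ht.1.trans ht.2.1)) (sub_pos.2 (ht.2.1.trans ht.2.2))).ne',
    spB_integrableOn_upper hz hz0 hz1⟩, rfl, rfl⟩

/-- **The rectangle `C(z) = [{0 < t₁ < z < t₀ < 1}, 1/(t₀(1 − t₁))]` exists** for real algebraic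
`0 < z < 1` (value `−log z · log(1 − z)`). [cite: KontsevichZagier2001, §1.1] -/
theorem spB_exists_rect {z : ℝ} (hz : IsAlgebraic ℚ z) (hz0 : 0 < z) (hz1 : z < 1) :
    ∃ C : IntegralRep 2, C.domain = {t | 0 < t 1 ∧ t 1 < z ∧ z < t 0 ∧ t 0 < 1} ∧
      C.integrand = fun t => 1 / (t 0 * (1 - t 1)) :=
  ⟨⟨_, _, spB_isSemialgebraic_rect hz,
    spB_isSemialgebraicFunOn_zetaTwoIntegrand (spB_isSemialgebraic_rect hz) fun _ ht =>
      (mul_pos (hz0.trans ht.2.2.1) (sub_pos.2 (ht.2.1.trans hz1))).ne',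
    spB_integrableOn_rect hz0 hz1⟩, rfl, rfl⟩

/-- **The triangle `Q(z) = [{0 < t₁ < t₀ < z}, 1/((1 − t₀)(1 − t₁))]` exists** for real algebraic
`0 < z < 1`. [cite: KontsevichZagier2001, §1.1] -/
theorem spB_exists_lower {z : ℝ} (hz : IsAlgebraic ℚ z) (hz1 : z < 1) :
    ∃ Q : IntegralRep 2, Q.domain = {t | 0 < t 1 ∧ t 1 < t 0 ∧ t 0 < z} ∧
      Q.integrand = fun t => 1 / ((1 - t 0) * (1 - t 1)) :=
  ⟨⟨_, _, spB_isSemialgebraic_triangle isAlgebraic_zero hz,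
    spB_isSemialgebraicFunOn_logSqIntegrand (spB_isSemialgebraic_triangle isAlgebraic_zero hz)
      fun _ ht =>
      (mul_pos (sub_pos.2 (ht.2.2.trans hz1)) (sub_pos.2 ((ht.2.1.trans ht.2.2).trans hz1))).ne',
    spB_integrableOn_of_subset_square hz1 (spB_lower_subset_Icc z)⟩, rfl, rfl⟩

/-- **The square `R(z) = [(0,z)², 1/((1 − t₀)(1 − t₁))]` exists** for real algebraic `0 < z < 1`
(value `log²(1 − z)`). [cite: KontsevichZagier2001, §1.1] -/
theorem spB_exists_square {z : ℝ} (hz : IsAlgebraic ℚ z) (hz1 : z < 1) :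
    ∃ R : IntegralRep 2, R.domain = {t | 0 < t 0 ∧ t 0 < z ∧ 0 < t 1 ∧ t 1 < z} ∧
      R.integrand = fun t => 1 / ((1 - t 0) * (1 - t 1)) :=
  ⟨⟨_, _, spB_isSemialgebraic_square hz,
    spB_isSemialgebraicFunOn_logSqIntegrand (spB_isSemialgebraic_square hz) fun _ ht =>
      (mul_pos (sub_pos.2 (ht.2.1.trans hz1)) (sub_pos.2 (ht.2.2.2.trans hz1))).ne',
    spB_integrableOn_of_subset_square hz1 (spB_square_subset_Icc z)⟩, rfl, rfl⟩

/-! ## The registered sub-goal -/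

/-- **Stub (existence of the simplex pieces of the dilogarithm layer; registered sub-goal
`exists_simplexPieces_two` of stmt-KontsevichZagierPeriods-3869, line `SketchIdeator1`).** For every
real algebraic `0 < z < 1`: the upper triangle `B(z) = [{z < t₁ < t₀ < 1}, 1/(t₀(1 − t₁))]`, the
rectangle `C(z) = [{0 < t₁ < z < t₀ < 1}, 1/(t₀(1 − t₁))]`, the triangle
`Q(z) = [{0 < t₁ < t₀ < z}, 1/((1 − t₀)(1 − t₁))]` and the square
`R(z) = [(0,z)², 1/((1 − t₀)(1 − t₁))]` exist as integral representations of the Kontsevich–Zagier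
calculus with literally these domains and integrands. [cite: KontsevichZagier2001, §1.1] -/
theorem exists_simplexPieces_two :
    (∀ z : ℝ, IsAlgebraic ℚ z → 0 < z → z < 1 →
      ∃ B : IntegralRep 2, B.domain = {t | z < t 1 ∧ t 1 < t 0 ∧ t 0 < 1} ∧
        B.integrand = fun t => 1 / (t 0 * (1 - t 1))) ∧
    (∀ z : ℝ, IsAlgebraic ℚ z → 0 < z → z < 1 →
      ∃ C : IntegralRep 2, C.domain = {t | 0 < t 1 ∧ t 1 < z ∧ z < t 0 ∧ t 0 < 1} ∧
        C.integrand = fun t => 1 / (t 0 * (1 - t 1))) ∧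
    (∀ z : ℝ, IsAlgebraic ℚ z → 0 < z → z < 1 →
      ∃ Q : IntegralRep 2, Q.domain = {t | 0 < t 1 ∧ t 1 < t 0 ∧ t 0 < z} ∧
        Q.integrand = fun t => 1 / ((1 - t 0) * (1 - t 1))) ∧
    (∀ z : ℝ, IsAlgebraic ℚ z → 0 < z → z < 1 →
      ∃ R : IntegralRep 2, R.domain = {t | 0 < t 0 ∧ t 0 < z ∧ 0 < t 1 ∧ t 1 < z} ∧
        R.integrand = fun t => 1 / ((1 - t 0) * (1 - t 1))) :=
  ⟨fun _ hz hz0 hz1 => spB_exists_upper hz hz0 hz1, fun _ hz hz0 hz1 => spB_exists_rect hz hz0 hz1,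
    fun _ hz _ hz1 => spB_exists_lower hz hz1, fun _ hz _ hz1 => spB_exists_square hz hz1⟩

end Summit.KontsevichZagierPeriods.HurwitzMicroSectors.NormalFormPrinciple.PiBox.Dilog
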